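import Summits.QuantumFields.YangMills.Theorems.SwapVirialDeficitZeroModeSigmaFourSmallBallScaling
import HarnessLib

/-!
# The LEADER CHART of the joint blow-up (brick J2 of memo-24197-massive-mode-rung): w3 g63's cone ∕ arrange ∕ straighten ∕ translate ∕ `dil3`
# chain for conjugation-invariant FUNCTIONS on `SU(2)⁴`
# (free-hands support of ⟨stmt-QuantumFields-24197⟩ `SwapVirialDeficit.SwapGluedStiffness`; companion of ✓`BlowUp.lintegral_haar_pi_eq_followerChart`)

w3 g63's Z5 files transport the SET `sigmaBall t` through `Haar⁴ = cone⁴ → arrange → straighten → translate → dil3 t` (✓`haar_sigmaBall_eq_scaled`).  The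
massive-mode rung needs the same chain for a FUNCTION of the four leaders (the follower integral `C ↦ Haar^{n}{F(C, ·) ≤ r·u}`, conjugation-invariant by
the global gauge symmetry of the tree-gauged ring).  This file:

* `leaderTuple a w` — the axial leader 4-tuple `(C₀, C₁, C₂, c) = (Q x, Q(p(A,x)·z), Q y, Q A)` at hub `a` and cone coordinates `w = ((x, y), z)`
  (`A = radialUnit (axisPoint a)`, `p = slaveP A x`, `Q = quatToSU2`) — literally the tuple of ✓`mem_rescaledSigma_iff` before dilation;
* §1 `quatToSU2_conj_unit` — `Q(ū·x·u) = (Q u)⁻¹·Q x·Q u`;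
* §2 ★★ `lintegral_haar_four_eq_coneFour` — for measurable `g ≥ 0` with `g (h·C·h⁻¹) = g C`: `∫⁻ g dHaar⁴ = ∫⁻ g (leaderTuple q.1 q.2) dconeFour(q)`;
* §3 ★★★ `lintegral_haar_four_eq_leaderChart` — `∫⁻ g dHaar⁴ = ofReal(coneConst³·t⁷) · ∫⁻_cone(a) ∫⁻ 𝟙_{ball3}(dil3 t w)·g (leaderTuple a (dil3 t w)) dvol³ dw`
  for every `t > 0` (hub Tonelli, ✓`coneThree_eq_smul_restrict`, linear change of variables ✓`det_dil3 = t⁷`) — the leader factor `t⁷ = u^{7/2}` of the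
  exact Jacobian `u^{9L⁴−1}` of the scaling identity (S) of ✓`BlowUp.smallBall_limit_real_of_blowUp_of_weight`.

HONEST LABEL: measure theory on `ℍ⁴`/`SU(2)⁴` (plan-level plumbing); NOT the fixed-`L` sharp law, NOT ⟨24197⟩; the Yang–Mills mass gap is NOT proved; no summit
is proved by a line.  Seat ym-line-fcl-p3 g45 (cell ym-idea-1, free hands; item of record ⟨24085⟩ aside, untouched), `--supports stmt-QuantumFields-24197`.
One `def` (`leaderTuple`), theorems otherwise; 0 `sorry`; standard axioms; the series' local `ℍ` instances.  References: [folklore].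
-/

set_option autoImplicit false

noncomputable section

open MeasureTheory Quaternion Set
open scoped Quaternion ENNReal BigOperators
open Literature.MathematicalPhysics.QuantumLattice
open Literature.MathematicalPhysics.QuantumFieldTheory (haarProbability)
open Literature.MathematicalPhysics.QuantumFieldTheory.Balaban1983to89.T4HaarSU2Translate (su2Quat_quatToSU2 mul_quatToSU2_mul su2Quat_mul su2Quat_one)
open Literature.Analysis.Calculus (radialUnit radialUnit_def norm_radialUnit)
open Summit.QuantumFields.YangMills.Theorems.SwapTwistDeficit.ToronLog
open Summit.QuantumFields.YangMills.Theorems.SwapVirialDeficit.ZeroModeGroup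

attribute [local instance] Literature.Analysis.FluidPDE.Tao2016.quatMeasurableSpace
  Literature.Analysis.FluidPDE.Tao2016.quatBorelSpace
  Literature.MathematicalPhysics.QuantumLattice.secondCountableTopology_su2

namespace Summit.QuantumFields.YangMills.Theorems.SwapVirialDeficit.BlowUp

open Summit.QuantumFields.YangMills.Theorems.SwapVirialDeficit.ZeroModeSigma

/-- **The axial leader 4-tuple** at hub `a` and cone coordinates `w = ((x, y), z)`: `(C₀, C₁, C₂, c) = (Q x, Q (p·z), Q y, Q A)` with `Q = quatToSU2`,
`A = radialUnit (axisPoint a)` the axial hub unit and `p = slaveP A x = Ā·x̂·A` the σ-slaving of `C₁ ≈ c⁻¹C₀c` (w3 g63's coordinates, cf. ✓`mem_rescaledSigma_iff`).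
[folklore] -/
def leaderTuple (a : ℍ) (w : (ℍ × ℍ) × ℍ) : Fin 4 → Matrix.specialUnitaryGroup (Fin 2) ℂ :=
  ![quatToSU2 w.1.1, quatToSU2 (slaveP (radialUnit (axisPoint a)) w.1.1 * w.2), quatToSU2 w.1.2, quatToSU2 (radialUnit (axisPoint a))]

/-- Components of `leaderTuple`. [folklore] -/
theorem leaderTuple_apply (a : ℍ) (w : (ℍ × ℍ) × ℍ) :
    leaderTuple a w 0 = quatToSU2 w.1.1 ∧ leaderTuple a w 1 = quatToSU2 (slaveP (radialUnit (axisPoint a)) w.1.1 * w.2) ∧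
      leaderTuple a w 2 = quatToSU2 w.1.2 ∧ leaderTuple a w 3 = quatToSU2 (radialUnit (axisPoint a)) :=
  ⟨rfl, rfl, rfl, rfl⟩

/-- A `Fin 4`-tuple built from four measurable components is measurable. [folklore] -/
theorem measurable_vec4 {α β : Type*} [MeasurableSpace α] [MeasurableSpace β] {f₀ f₁ f₂ f₃ : α → β}
    (h₀ : Measurable f₀) (h₁ : Measurable f₁) (h₂ : Measurable f₂) (h₃ : Measurable f₃) :
    Measurable fun a => (![f₀ a, f₁ a, f₂ a, f₃ a] : Fin 4 → β) := by
  refine measurable_pi_lambda _ fun μ => ?_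
  fin_cases μ
  · exact h₀
  · exact h₁
  · exact h₂
  · exact h₃

/-- `(a, w) ↦ leaderTuple a w` is measurable. [folklore] -/
theorem measurable_leaderTuple : Measurable fun q : ℍ × ((ℍ × ℍ) × ℍ) => leaderTuple q.1 q.2 := by
  have hA : Measurable fun q : ℍ × ((ℍ × ℍ) × ℍ) => radialUnit (axisPoint q.1) := measurable_axisUnit.comp measurable_fst
  have hx : Measurable fun q : ℍ × ((ℍ × ℍ) × ℍ) => q.2.1.1 := measurable_fst.comp (measurable_fst.comp measurable_snd)
  have hy : Measurable fun q : ℍ × ((ℍ × ℍ) × ℍ) => q.2.1.2 := measurable_snd.comp (measurable_fst.comp measurable_snd)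
  have hz : Measurable fun q : ℍ × ((ℍ × ℍ) × ℍ) => q.2.2 := measurable_snd.comp measurable_snd
  have hp : Measurable fun q : ℍ × ((ℍ × ℍ) × ℍ) => slaveP (radialUnit (axisPoint q.1)) q.2.1.1 * q.2.2 :=
    (measurable_slaveP.comp (hA.prodMk hx)).mul hz
  exact measurable_vec4 (measurable_quatToSU2.comp hx) (measurable_quatToSU2.comp hp) (measurable_quatToSU2.comp hy)
    (measurable_quatToSU2.comp hA)

/-! ## §1 Conjugation by a unit quaternion through `quatToSU2` -/

/-- ★ `Q(ū·x·u) = (Q u)⁻¹ · Q x · Q u` for a unit quaternion `u` and `x ≠ 0` (`Q = quatToSU2`). [folklore] -/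
theorem quatToSU2_conj_unit {u x : ℍ} (hu : ‖u‖ = 1) (hx : x ≠ 0) :
    quatToSU2 (star u * x * u) = (quatToSU2 u)⁻¹ * quatToSU2 x * quatToSU2 u := by
  have hu0 : u ≠ 0 := by
    intro h; rw [h, norm_zero] at hu; exact zero_ne_one hu
  have hsu : su2Quat (quatToSU2 u) = u := by rw [su2Quat_quatToSU2 hu0, hu, inv_one, one_smul]
  have hsinv : su2Quat (quatToSU2 u)⁻¹ = star u := by
    have h1 : su2Quat (quatToSU2 u)⁻¹ * su2Quat (quatToSU2 u) = 1 := by rw [← su2Quat_mul, inv_mul_cancel, su2Quat_one]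
    have hn : Quaternion.normSq u = 1 := by rw [Quaternion.normSq_eq_norm_mul_self, hu, mul_one]
    have h2 : star u * u = 1 := by rw [Quaternion.star_mul_self, hn, Quaternion.coe_one]
    rw [hsu] at h1
    exact mul_right_cancel₀ hu0 (h1.trans h2.symm)
  rw [mul_quatToSU2_mul _ _ hx, hsinv, hsu]

/-! ## §2 Haar⁴ through the arranged, straightened, translated cone -/

/-- ★★ **Haar⁴ in w3's cone coordinates**: for a measurable `g ≥ 0` on `SU(2)⁴` invariant under simultaneous conjugation,
`∫⁻ g dHaar⁴ = ∫⁻ g (leaderTuple q.1 q.2) dconeFour(q)` — radial projection of `cone⁴` (✓`measurePreserving_proj`), the arrangement hub = letter `3`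
(✓`measurePreserving_arrange`), the straightening skew product (✓`measurePreserving_straighten`, using the invariance and ✓`conj_hubUnit_radialUnit`) and the
translation of the slaved letter (✓`measurePreserving_translate_skew`). [folklore] -/
theorem lintegral_haar_four_eq_coneFour (g : (Fin 4 → Matrix.specialUnitaryGroup (Fin 2) ℂ) → ℝ≥0∞) (hg : Measurable g)
    (hinv : ∀ (h : Matrix.specialUnitaryGroup (Fin 2) ℂ) (C : Fin 4 → Matrix.specialUnitaryGroup (Fin 2) ℂ),
      g (fun μ => h * C μ * h⁻¹) = g C) :
    ∫⁻ C, g C ∂(Measure.pi fun _ : Fin 4 => haarProbability (Matrix.specialUnitaryGroup (Fin 2) ℂ)) =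
      ∫⁻ q, g (leaderTuple q.1 q.2) ∂coneFour := by
  haveI := isProbabilityMeasure_coneMeasure
  haveI := isProbabilityMeasure_coneThree
  -- (i) radial projection of `cone⁴`
  have h1 := (measurePreserving_proj).lintegral_comp hg
  rw [← h1]
  -- (ii) arrangement: `v ↦ (v 3, ((v 0, v 2), v 1))`
  set G₀ : ℍ × ((ℍ × ℍ) × ℍ) → ℝ≥0∞ := fun q => g ![quatToSU2 q.2.1.1, quatToSU2 q.2.2, quatToSU2 q.2.1.2, quatToSU2 q.1] with hG₀
  have hG₀m : Measurable G₀ :=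
    hg.comp (measurable_vec4 (measurable_quatToSU2.comp (measurable_fst.comp (measurable_fst.comp measurable_snd)))
      (measurable_quatToSU2.comp (measurable_snd.comp measurable_snd))
      (measurable_quatToSU2.comp (measurable_snd.comp (measurable_fst.comp measurable_snd))) (measurable_quatToSU2.comp measurable_fst))
  have h2 := measurePreserving_arrange.lintegral_comp hG₀m
  have h2' : (fun v : Fin 4 → ℍ => G₀ (arrange v)) = fun v => g (fun μ => quatToSU2 (v μ)) := by
    funext v
    simp only [hG₀, arrange]
    congr 1
    funext μ
    fin_cases μ <;> rfl
  rw [h2'] at h2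
  rw [h2]
  -- (iii) straightening: `G₀ = G₁ ∘ straighten` a.e., `G₁` the axial integrand
  set G₁ : ℍ × ((ℍ × ℍ) × ℍ) → ℝ≥0∞ := fun q =>
    g ![quatToSU2 q.2.1.1, quatToSU2 q.2.2, quatToSU2 q.2.1.2, quatToSU2 (radialUnit (axisPoint q.1))] with hG₁
  have hG₁m : Measurable G₁ :=
    hg.comp (measurable_vec4 (measurable_quatToSU2.comp (measurable_fst.comp (measurable_fst.comp measurable_snd)))
      (measurable_quatToSU2.comp (measurable_snd.comp measurable_snd))
      (measurable_quatToSU2.comp (measurable_snd.comp (measurable_fst.comp measurable_snd)))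
      (measurable_quatToSU2.comp (measurable_axisUnit.comp measurable_fst)))
  have h3 := measurePreserving_straighten.lintegral_comp hG₁m
  have h3' : ∫⁻ q, G₀ q ∂coneFour = ∫⁻ q, G₁ (q.1, conj3 (hubUnit q.1) q.2) ∂coneFour := by
    refine lintegral_congr_ae ?_
    filter_upwards [ae_coneFour_good] with q hq
    obtain ⟨hqa, ha, hx, hy, hz⟩ := hq
    have hu : ‖hubUnit q.1‖ = 1 := norm_unitConeQ hqa
    have hu0 : hubUnit q.1 ≠ 0 := by
      intro h; rw [h, norm_zero] at hu; exact zero_ne_one hu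
    have hra : radialUnit q.1 ≠ 0 := by
      intro h; have := norm_radialUnit ha; rw [h, norm_zero] at this; exact zero_ne_one this
    -- the axial hub unit is the straightened hub
    have hA : radialUnit (axisPoint q.1) = star (hubUnit q.1) * radialUnit q.1 * hubUnit q.1 := (conj_hubUnit_radialUnit hqa).symm
    have hQa : quatToSU2 (radialUnit q.1) = quatToSU2 q.1 := by
      rw [radialUnit_def, quatToSU2_smul (inv_pos.2 (norm_pos_iff.2 ha))]
    simp only [hG₀, hG₁, conj3]
    rw [hA, quatToSU2_conj_unit hu hx, quatToSU2_conj_unit hu hz, quatToSU2_conj_unit hu hy, quatToSU2_conj_unit hu hra, hQa]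
    have e : (![(quatToSU2 (hubUnit q.1))⁻¹ * quatToSU2 q.2.1.1 * quatToSU2 (hubUnit q.1),
        (quatToSU2 (hubUnit q.1))⁻¹ * quatToSU2 q.2.2 * quatToSU2 (hubUnit q.1),
        (quatToSU2 (hubUnit q.1))⁻¹ * quatToSU2 q.2.1.2 * quatToSU2 (hubUnit q.1),
        (quatToSU2 (hubUnit q.1))⁻¹ * quatToSU2 q.1 * quatToSU2 (hubUnit q.1)] : Fin 4 → Matrix.specialUnitaryGroup (Fin 2) ℂ) =
        fun μ => (quatToSU2 (hubUnit q.1))⁻¹ * (![quatToSU2 q.2.1.1, quatToSU2 q.2.2, quatToSU2 q.2.1.2, quatToSU2 q.1] :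
          Fin 4 → Matrix.specialUnitaryGroup (Fin 2) ℂ) μ * (quatToSU2 (hubUnit q.1))⁻¹⁻¹ := by
      funext μ
      rw [inv_inv]
      fin_cases μ <;> rfl
    rw [e, hinv]
  rw [h3', h3]
  -- (iv) translation of the slaved letter: `G₁ ∘ translate_skew = g ∘ leaderTuple`
  have hGm : Measurable fun q : ℍ × ((ℍ × ℍ) × ℍ) => g (leaderTuple q.1 q.2) := hg.comp measurable_leaderTuple
  have h4 := measurePreserving_translate_skew.lintegral_comp hG₁m
  have h4' : (fun q : ℍ × ((ℍ × ℍ) × ℍ) => G₁ (q.1, translate (radialUnit (axisPoint q.1)) q.2)) = fun q => g (leaderTuple q.1 q.2) := by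
    funext q
    simp only [hG₁, translate_apply, leaderTuple]
  rw [h4'] at h4
  exact h4.symm

/-! ## §3 Hub Tonelli and the exact `t⁷` -/

/-- Lebesgue measure on `(ℍ × ℍ) × ℍ` rescales under `dil3 t` by `t⁷`: `∫⁻ H dvol³ = t⁷ · ∫⁻ H ∘ dil3 t dvol³` (`t > 0`, measurable `H ≥ 0`). [folklore] -/
theorem lintegral_volume3_eq_dil3 {t : ℝ} (ht : 0 < t) (H : (ℍ × ℍ) × ℍ → ℝ≥0∞) (hH : Measurable H) :
    ∫⁻ w, H w ∂(volume : Measure ((ℍ × ℍ) × ℍ)) = ENNReal.ofReal (t ^ 7) * ∫⁻ w, H (dil3 t w) ∂(volume : Measure ((ℍ × ℍ) × ℍ)) := by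
  haveI := isAddHaarMeasure_volume3
  have hdet : LinearMap.det (dil3 t) ≠ 0 := by rw [det_dil3]; positivity
  have h7 : 0 < t ^ 7 := by positivity
  have hmap : (volume : Measure ((ℍ × ℍ) × ℍ)).map (dil3 t) = ENNReal.ofReal ((t ^ 7)⁻¹) • (volume : Measure ((ℍ × ℍ) × ℍ)) := by
    rw [Measure.map_linearMap_addHaar_eq_smul_addHaar volume hdet, det_dil3, abs_inv, abs_of_pos h7]
  have h1 : ∫⁻ w, H (dil3 t w) ∂(volume : Measure ((ℍ × ℍ) × ℍ)) = ∫⁻ w, H w ∂((volume : Measure ((ℍ × ℍ) × ℍ)).map (dil3 t)) :=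
    (lintegral_map hH (measurable_dil3 t)).symm
  rw [h1, hmap, lintegral_smul_measure, smul_eq_mul, ← mul_assoc, ← ENNReal.ofReal_mul h7.le, mul_inv_cancel₀ h7.ne',
    ENNReal.ofReal_one, one_mul]

/-- ★★★ **THE LEADER CHART**: for a measurable `g ≥ 0` on `SU(2)⁴` invariant under simultaneous conjugation and every scale `t > 0`,
`∫⁻ g dHaar⁴ = ofReal(coneConst³·t⁷) · ∫⁻_cone(a) ∫⁻ 𝟙_{ball3}(dil3 t w) · g (leaderTuple a (dil3 t w)) dvol³(w)` — the leader factor of the exact Jacobian of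
the joint blow-up (brick J2; with `g = 𝟙_{sigmaBall t}` this is ✓`haar_sigmaBall_eq_scaled`). [folklore] -/
theorem lintegral_haar_four_eq_leaderChart (g : (Fin 4 → Matrix.specialUnitaryGroup (Fin 2) ℂ) → ℝ≥0∞) (hg : Measurable g)
    (hinv : ∀ (h : Matrix.specialUnitaryGroup (Fin 2) ℂ) (C : Fin 4 → Matrix.specialUnitaryGroup (Fin 2) ℂ),
      g (fun μ => h * C μ * h⁻¹) = g C) {t : ℝ} (ht : 0 < t) :
    ∫⁻ C, g C ∂(Measure.pi fun _ : Fin 4 => haarProbability (Matrix.specialUnitaryGroup (Fin 2) ℂ)) =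
      ENNReal.ofReal (coneConst ^ 3 * t ^ 7) *
        ∫⁻ a, ∫⁻ w, ball3.indicator (fun w' => g (leaderTuple a w')) (dil3 t w) ∂(volume : Measure ((ℍ × ℍ) × ℍ)) ∂coneMeasure := by
  haveI := isProbabilityMeasure_coneMeasure
  haveI := isProbabilityMeasure_coneThree
  have hGm : Measurable fun q : ℍ × ((ℍ × ℍ) × ℍ) => g (leaderTuple q.1 q.2) := hg.comp measurable_leaderTuple
  rw [lintegral_haar_four_eq_coneFour g hg hinv, coneFour, lintegral_prod _ hGm.aemeasurable]
  -- the inner `coneThree` integral at a fixed hub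
  have hinner : ∀ a : ℍ, ∫⁻ w, g (leaderTuple a w) ∂coneThree =
      ENNReal.ofReal coneConst ^ 3 * (ENNReal.ofReal (t ^ 7) *
        ∫⁻ w, ball3.indicator (fun w' => g (leaderTuple a w')) (dil3 t w) ∂(volume : Measure ((ℍ × ℍ) × ℍ))) := by
    intro a
    have hga : Measurable fun w : (ℍ × ℍ) × ℍ => g (leaderTuple a w) := hGm.comp (measurable_const.prodMk measurable_id)
    have hind : Measurable (ball3.indicator fun w' => g (leaderTuple a w')) := hga.indicator measurableSet_ball3
    rw [coneThree_eq_smul_restrict, lintegral_smul_measure, smul_eq_mul, ← lintegral_indicator measurableSet_ball3,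
      lintegral_volume3_eq_dil3 ht _ hind]
  simp only [hinner]
  have hc0 : 0 ≤ coneConst := by rw [coneConst]; exact ENNReal.toReal_nonneg
  have hm : Measurable fun a : ℍ => ∫⁻ w, ball3.indicator (fun w' => g (leaderTuple a w')) (dil3 t w) ∂(volume : Measure ((ℍ × ℍ) × ℍ)) := by
    have hj : Measurable fun q : ℍ × ((ℍ × ℍ) × ℍ) => ball3.indicator (fun w' => g (leaderTuple q.1 w')) (dil3 t q.2) := by
      have e : (fun q : ℍ × ((ℍ × ℍ) × ℍ) => ball3.indicator (fun w' => g (leaderTuple q.1 w')) (dil3 t q.2)) =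
          {q : ℍ × ((ℍ × ℍ) × ℍ) | dil3 t q.2 ∈ ball3}.indicator (fun q => g (leaderTuple q.1 (dil3 t q.2))) := by
        funext q
        by_cases hq : dil3 t q.2 ∈ ball3
        · rw [Set.indicator_of_mem hq, Set.indicator_of_mem (show q ∈ {q : ℍ × ((ℍ × ℍ) × ℍ) | dil3 t q.2 ∈ ball3} from hq)]
        · rw [Set.indicator_of_notMem hq, Set.indicator_of_notMem (show q ∉ {q : ℍ × ((ℍ × ℍ) × ℍ) | dil3 t q.2 ∈ ball3} from hq)]
      rw [e]
      exact (hGm.comp (measurable_fst.prodMk ((measurable_dil3 t).comp measurable_snd))).indicator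
        (measurableSet_ball3.preimage ((measurable_dil3 t).comp measurable_snd))
    exact hj.lintegral_prod_right'
  rw [lintegral_const_mul _ (hm.const_mul _), lintegral_const_mul _ hm, ← mul_assoc, ← ENNReal.ofReal_pow hc0,
    ← ENNReal.ofReal_mul (by positivity)]

end Summit.QuantumFields.YangMills.Theorems.SwapVirialDeficit.BlowUp

end
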